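import Literature.AnabelianGeometry.SemiGraphs.TreeSystemStarCondition
import HarnessLib

/-!
# [SemiAnbd] Theorem 3.7 (iii): a compatible fixed subjoint system of the trees is killed by estrangement

Mochizuki, *Semi-graphs of anabelioids*, Publ. RIMS **42** (2006), §3, Theorem 3.7 (iii), manuscript
p. 41 [cite: MochizukiSemiAnbd2006, Thm 3.7(iii) p.41], third paragraph of the proof, with the author's
*Comments* (2020), item (6)(b): "we may choose a compatible system of such subjoints [i.e., on which `H`
acts trivially] … But this implies [cf. Remark 2.2.1] that `H` is contained … for two distinct branches
`b`, `b'` abutting to `v` …, in the intersection of the images of `π̂₁(𝒢_e)`, `π̂₁(𝒢_{e'})`, via `b`, `b'`.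
But since `𝒢` is assumed to be totally estranged, we thus conclude that `H` is trivial".

The cell's route through the condition (∗_j) (`SemiGraph.hstar_of_noFixedBranchPairSystem`, seat
abc-iut-L3-t11) packages this step as the hypothesis `hnobp` — no nontrivial subgroup `C` fixes a
compatible branch-pair system `(w_i; β_i ≠ β'_i)` of the FINITE LEVELS `G_i` — and derives (∗_j) from it
by a compactness argument over the finite levels.  This file isolates the finiteness-free half: a
compatible `C`-fixed SUBJOINT system of the TREES `T_i` (a vertex with two distinct abutting branches at
every level `i ≥ j₀`, compatible under the transition maps, fixed by `C`) pushes down along the universal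
graph-coverings `q_i : T_i → G_i` (immersions, equivariant, compatible with the transitions) to a
compatible `C`-fixed branch-pair system of the levels, so `hnobp` forces `C = ⊥`
(`SemiGraph.eq_bot_of_fixedSubjointSystem`; edge form `SemiGraph.eq_bot_of_fixedEdgePairSystem`).  No
finiteness of the levels is assumed: this is the "estrangement kill" consumed by the bounded-geodesic
route to the adjacency clause of Thm. 3.7 (iii) at an infinite countable `𝒢` (cell gap G-t6g3-2, row
E2-bounded), where a compatible fixed subjoint system arises from a stabilised fixed geodesic.

No definitions; nothing here takes a side on [IUTchIII] Cor. 3.12.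
-/

namespace Literature.AnabelianGeometry.SemiGraphs

namespace SemiGraph

open CategoryTheory

universe w v u

/-- **A compatible fixed subjoint system of the trees is impossible for `C ≠ 1`** ([SemiAnbd] p. 41,
third paragraph, with Comments (6)(b)): given trees `T_i` with `C`-actions `ρ_i`, transition morphisms
`f`, levels `G_i` with actions `τ_i`, equivariant immersions `q_i : T_i → G_i` compatible with the
transitions (`hsq`), and the estrangement hypothesis `hnobp` (no nontrivial `C` fixes a compatible
level branch-pair system, the output of `noFixedBranchPairSystem_of_isTotallyEstranged_cpt`), a
compatible `C`-fixed system `(m_i; δ_i ≠ δ'_i)_{i ≥ j₀}` of tree vertices with two distinct abutting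
branches forces `C = ⊥` — push it down along the `q_i` (immersions keep the branches distinct).  No
finiteness of the `G_i`. [cite: MochizukiSemiAnbd2006, Thm 3.7(iii) p.41] -/
theorem eq_bot_of_fixedSubjointSystem {P : Type w} [Group P] (C : Subgroup P)
    {J : Type v} [Preorder J]
    (T : J → SemiGraph.{u}) (ρ : ∀ j, P →* Aut (T j)) (f : ∀ ⦃i j : J⦄, i ≤ j → (T j ⟶ T i))
    (G : J → SemiGraph.{u}) (τ : ∀ j, P →* Aut (G j)) (q : ∀ j, T j ⟶ G j)
    (hq : ∀ j, IsImmersion (q j)) (hqe : ∀ (j : J) (g : P), (ρ j g).hom ≫ q j = q j ≫ (τ j g).hom)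
    (gf : ∀ ⦃i j : J⦄, i ≤ j → (G j ⟶ G i)) (hsq : ∀ ⦃i j : J⦄ (h : i ≤ j), f h ≫ q i = q j ≫ gf h)
    (hnobp : ∀ (j₀ : J) (w : ∀ i : {i : J // j₀ ≤ i}, (G i.1).Vertex)
      (β β' : ∀ i : {i : J // j₀ ≤ i}, (G i.1).Branch),
      (∀ i, β i ≠ β' i ∧ (G i.1).abuts (β i) = some (w i) ∧ (G i.1).abuts (β' i) = some (w i)) →
      (∀ ⦃i i' : {i : J // j₀ ≤ i}⦄ (h : i.1 ≤ i'.1), (gf h).vertexMap (w i') = w i ∧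
        (gf h).branchMap (β i') = β i ∧ (gf h).branchMap (β' i') = β' i) →
      (∀ (i : {i : J // j₀ ≤ i}) (γ : C), (τ i.1 γ).hom.vertexMap (w i) = w i ∧
        (τ i.1 γ).hom.branchMap (β i) = β i ∧ (τ i.1 γ).hom.branchMap (β' i) = β' i) → C = ⊥)
    (j₀ : J) (m : ∀ i : {i : J // j₀ ≤ i}, (T i.1).Vertex)
    (δ δ' : ∀ i : {i : J // j₀ ≤ i}, (T i.1).Branch)
    (hpair : ∀ i, δ i ≠ δ' i ∧ (T i.1).abuts (δ i) = some (m i) ∧ (T i.1).abuts (δ' i) = some (m i))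
    (hcompat : ∀ ⦃i i' : {i : J // j₀ ≤ i}⦄ (h : i.1 ≤ i'.1), (f h).vertexMap (m i') = m i ∧
      (f h).branchMap (δ i') = δ i ∧ (f h).branchMap (δ' i') = δ' i)
    (hfix : ∀ (i : {i : J // j₀ ≤ i}) (γ : C), (ρ i.1 γ).hom.vertexMap (m i) = m i ∧
      (ρ i.1 γ).hom.branchMap (δ i) = δ i ∧ (ρ i.1 γ).hom.branchMap (δ' i) = δ' i) :
    C = ⊥ := by
  refine hnobp j₀ (fun i => (q i.1).vertexMap (m i)) (fun i => (q i.1).branchMap (δ i))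
    (fun i => (q i.1).branchMap (δ' i)) (fun i => ⟨fun heq => (hpair i).1 ?_,
      (q i.1).abuts_branchMap _ _ (hpair i).2.1, (q i.1).abuts_branchMap _ _ (hpair i).2.2⟩)
    (fun i i' h => ⟨?_, ?_, ?_⟩) (fun i γ => ⟨?_, ?_, ?_⟩)
  · -- immersions keep distinct branches at a vertex distinct
    have hinj := hq i.1 (m i) (a₁ := ⟨δ i, (hpair i).2.1⟩) (a₂ := ⟨δ' i, (hpair i).2.2⟩)
      (Subtype.ext heq)
    exact congrArg Subtype.val hinj
  · have hc := congrArg (fun φ : T i'.1 ⟶ G i.1 => φ.vertexMap (m i')) (hsq h)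
    simp only [comp_vertexMap, Function.comp_apply] at hc
    rw [← hc, (hcompat h).1]
  · have hc := congrArg (fun φ : T i'.1 ⟶ G i.1 => φ.branchMap (δ i')) (hsq h)
    simp only [comp_branchMap, Function.comp_apply] at hc
    rw [← hc, (hcompat h).2.1]
  · have hc := congrArg (fun φ : T i'.1 ⟶ G i.1 => φ.branchMap (δ' i')) (hsq h)
    simp only [comp_branchMap, Function.comp_apply] at hc
    rw [← hc, (hcompat h).2.2]
  · have he := congrArg (fun φ : T i.1 ⟶ G i.1 => φ.vertexMap (m i)) (hqe i.1 γ)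
    simp only [comp_vertexMap, Function.comp_apply] at he
    rw [← he, (hfix i γ).1]
  · have he := congrArg (fun φ : T i.1 ⟶ G i.1 => φ.branchMap (δ i)) (hqe i.1 γ)
    simp only [comp_branchMap, Function.comp_apply] at he
    rw [← he, (hfix i γ).2.1]
  · have he := congrArg (fun φ : T i.1 ⟶ G i.1 => φ.branchMap (δ' i)) (hqe i.1 γ)
    simp only [comp_branchMap, Function.comp_apply] at he
    rw [← he, (hfix i γ).2.2]

/-- The branch of an edge at a vertex of a tree is unique: two branches of the same edge abutting to
the same vertex coincide (else the edge is a loop `v – e – v` in the acyclic subdivision).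
[cite: MochizukiSemiAnbd2006, §1 p.13] -/
theorem branch_unique_of_isTree {G : SemiGraph.{u}} (hG : G.IsTree) {e : G.Edge} {b b' : G.Branch}
    {v : G.Vertex} (hb : G.edgeOf b = e) (hb' : G.edgeOf b' = e) (hbv : G.abuts b = some v)
    (hb'v : G.abuts b' = some v) : b = b' := by
  by_contra hne
  have hA : G.subdivision.IsAcyclic := hG.isTree.isAcyclic
  have a₁ : G.subdivision.Adj (Sum.inl v) (Sum.inr (Sum.inr b)) :=
    (G.subdivision_adj_inl_iff v _).mpr ⟨b, hbv, rfl⟩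
  have a₂ : G.subdivision.Adj (Sum.inr (Sum.inr b)) (Sum.inr (Sum.inl e)) :=
    (G.subdivision_adj_branch_iff b _).mpr (Or.inl (by rw [hb]))
  have a₁' : G.subdivision.Adj (Sum.inl v) (Sum.inr (Sum.inr b')) :=
    (G.subdivision_adj_inl_iff v _).mpr ⟨b', hb'v, rfl⟩
  have a₂' : G.subdivision.Adj (Sum.inr (Sum.inr b')) (Sum.inr (Sum.inl e)) :=
    (G.subdivision_adj_branch_iff b' _).mpr (Or.inl (by rw [hb']))
  let p : G.subdivision.Walk (Sum.inl v) (Sum.inr (Sum.inl e)) :=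
    SimpleGraph.Walk.cons a₁ (SimpleGraph.Walk.cons a₂ SimpleGraph.Walk.nil)
  let p' : G.subdivision.Walk (Sum.inl v) (Sum.inr (Sum.inl e)) :=
    SimpleGraph.Walk.cons a₁' (SimpleGraph.Walk.cons a₂' SimpleGraph.Walk.nil)
  have hp : p.IsPath := by simp [p, SimpleGraph.Walk.isPath_def]
  have hp' : p'.IsPath := by simp [p', SimpleGraph.Walk.isPath_def]
  have h := congrArg (fun r : G.subdivision.Path _ _ => r.1.getVert 1) (hA.path_unique ⟨p, hp⟩ ⟨p', hp'⟩)
  simp [p, p'] at h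
  exact hne h

/-- An automorphism of a tree fixing an edge and a vertex it abuts to fixes the branch of the edge at
that vertex. [cite: MochizukiSemiAnbd2006, §1 p.13] -/
theorem branchMap_eq_of_edgeMap_vertexMap_eq {G : SemiGraph.{u}} (hG : G.IsTree) (σ : Aut G)
    {b : G.Branch} {v : G.Vertex} (hbv : G.abuts b = some v)
    (he : σ.hom.edgeMap (G.edgeOf b) = G.edgeOf b) (hv : σ.hom.vertexMap v = v) :
    σ.hom.branchMap b = b :=
  branch_unique_of_isTree hG (by rw [σ.hom.edgeOf_branchMap, he]) rfl
    (by rw [σ.hom.abuts_branchMap b v hbv, hv]) hbv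

/-- **Edge form of the kill**: a compatible system `(m_i; ε_i ≠ ε'_i)_{i ≥ j₀}` of tree vertices with
two distinct `C`-fixed edges abutting to them (compatible under the transition maps, `m_i` fixed by
`C`) forces `C = ⊥` under `hnobp` — the branches of `ε_i`, `ε'_i` at `m_i` are unique (trees), hence
compatible and fixed, and `eq_bot_of_fixedSubjointSystem` applies.  This is the shape produced by a
stabilised `C`-fixed geodesic through `m_i`. [cite: MochizukiSemiAnbd2006, Thm 3.7(iii) p.41] -/
theorem eq_bot_of_fixedEdgePairSystem {P : Type w} [Group P] (C : Subgroup P)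
    {J : Type v} [Preorder J]
    (T : J → SemiGraph.{u}) (hT : ∀ j, (T j).IsTree) (ρ : ∀ j, P →* Aut (T j))
    (f : ∀ ⦃i j : J⦄, i ≤ j → (T j ⟶ T i))
    (G : J → SemiGraph.{u}) (τ : ∀ j, P →* Aut (G j)) (q : ∀ j, T j ⟶ G j)
    (hq : ∀ j, IsImmersion (q j)) (hqe : ∀ (j : J) (g : P), (ρ j g).hom ≫ q j = q j ≫ (τ j g).hom)
    (gf : ∀ ⦃i j : J⦄, i ≤ j → (G j ⟶ G i)) (hsq : ∀ ⦃i j : J⦄ (h : i ≤ j), f h ≫ q i = q j ≫ gf h)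
    (hnobp : ∀ (j₀ : J) (w : ∀ i : {i : J // j₀ ≤ i}, (G i.1).Vertex)
      (β β' : ∀ i : {i : J // j₀ ≤ i}, (G i.1).Branch),
      (∀ i, β i ≠ β' i ∧ (G i.1).abuts (β i) = some (w i) ∧ (G i.1).abuts (β' i) = some (w i)) →
      (∀ ⦃i i' : {i : J // j₀ ≤ i}⦄ (h : i.1 ≤ i'.1), (gf h).vertexMap (w i') = w i ∧
        (gf h).branchMap (β i') = β i ∧ (gf h).branchMap (β' i') = β' i) →
      (∀ (i : {i : J // j₀ ≤ i}) (γ : C), (τ i.1 γ).hom.vertexMap (w i) = w i ∧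
        (τ i.1 γ).hom.branchMap (β i) = β i ∧ (τ i.1 γ).hom.branchMap (β' i) = β' i) → C = ⊥)
    (j₀ : J) (m : ∀ i : {i : J // j₀ ≤ i}, (T i.1).Vertex)
    (ε ε' : ∀ i : {i : J // j₀ ≤ i}, (T i.1).Edge)
    (hpair : ∀ i, ε i ≠ ε' i ∧ (T i.1).EdgeAbuts (ε i) (m i) ∧ (T i.1).EdgeAbuts (ε' i) (m i))
    (hcompat : ∀ ⦃i i' : {i : J // j₀ ≤ i}⦄ (h : i.1 ≤ i'.1), (f h).vertexMap (m i') = m i ∧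
      (f h).edgeMap (ε i') = ε i ∧ (f h).edgeMap (ε' i') = ε' i)
    (hfix : ∀ (i : {i : J // j₀ ≤ i}) (γ : C), (ρ i.1 γ).hom.vertexMap (m i) = m i ∧
      (ρ i.1 γ).hom.edgeMap (ε i) = ε i ∧ (ρ i.1 γ).hom.edgeMap (ε' i) = ε' i) :
    C = ⊥ := by
  -- the branches of `ε i`, `ε' i` at `m i`
  choose δ hδe hδm using fun i => (hpair i).2.1
  choose δ' hδ'e hδ'm using fun i => (hpair i).2.2
  refine eq_bot_of_fixedSubjointSystem C T ρ f G τ q hq hqe gf hsq hnobp j₀ m δ δ'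
    (fun i => ⟨fun h => (hpair i).1 (by rw [← hδe i, ← hδ'e i, h]), hδm i, hδ'm i⟩)
    (fun i i' h => ⟨(hcompat h).1, ?_, ?_⟩) (fun i γ => ⟨(hfix i γ).1, ?_, ?_⟩)
  · exact branch_unique_of_isTree (hT i.1) (by rw [(f h).edgeOf_branchMap, hδe i', (hcompat h).2.1])
      (hδe i) (by rw [(f h).abuts_branchMap _ _ (hδm i'), (hcompat h).1]) (hδm i)
  · exact branch_unique_of_isTree (hT i.1) (by rw [(f h).edgeOf_branchMap, hδ'e i', (hcompat h).2.2])
      (hδ'e i) (by rw [(f h).abuts_branchMap _ _ (hδ'm i'), (hcompat h).1]) (hδ'm i)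
  · exact branchMap_eq_of_edgeMap_vertexMap_eq (hT i.1) (ρ i.1 γ) (hδm i)
      (by rw [hδe i]; exact (hfix i γ).2.1) (hfix i γ).1
  · exact branchMap_eq_of_edgeMap_vertexMap_eq (hT i.1) (ρ i.1 γ) (hδ'm i)
      (by rw [hδ'e i]; exact (hfix i γ).2.2) (hfix i γ).1

end SemiGraph

end Literature.AnabelianGeometry.SemiGraphs
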